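import Literature.Probability.LatticeModels.MedialCornerTrailWinding
import Literature.Probability.LatticeModels.FKExplorationDomainMarkov
import HarnessLib

/-!
# The winding of an exploration prefix closed by a virtual path is read off the closing path

Topic `Literature/Probability/LatticeModels`; sequel of `MedialCornerTrailWinding.lean` (closed
corner trails are cycles of the turning rule; signed Umlaufsatz `IsCornerTrail.inv`; sign pinned by an
extreme dart). The spin-`σ` parafermionic observable of a medial exploration weighs the passage
through a dart by `exp (-i σ W)`, `W = (π/2) · turnCount β c₀ j` the winding of the exploration PREFIX
from the start dart (`turnCount`, `ExplorationWinding` / `FermionicObservableSums`). Along a boundary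
arc this winding is deterministic: "since the edge `e` is along the free arc, the winding
`W_γ(e_a, e)` of the exploration path at `e` is constant" (Duminil-Copin–Hongler–Nolin 2011, Lemma 12;
Duminil-Copin–Smirnov 2012, Prop. 7.8). The mechanism, configuration-free:

* `turnCount_congr` — the turn count up to time `j` only sees the status of the first `j` target
  edges (the orbit version is the tree's `cornerOrbit_congr`, `FKExplorationDomainMarkov.lean`);
* `turnCount_eq_sum_trailSign` — if a corner sequence `c` agrees with the orbit of `c₀` under `β` up
  to time `j`, then `turnCount β c₀ j = ∑_{m<j} trailSign c m`;
* `IsCornerTrail.sum_trailSign_eq_four_of_top` and three variants — the sign of a closed corner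
  trail pinned by an extreme HORIZONTAL dart (top/bottom row; the prequel has the vertical ones);
* `turnCount_eq_of_west_south` (and `…_west_north`, `…_east_north`, `…_east_south`, `…_top_west`,
  `…_top_east`, `…_bot_east`, `…_bot_west`) — **if a CLOSED corner trail of length `Q ≥ j` extends
  the first `j` exploration steps (a "virtual" closing path, e.g. through boundary darts no
  exploration can use) and has a southward dart in its westmost medial column (resp. the analogous
  extreme dart), then `turnCount β c₀ j = 4 - ∑_{j ≤ m < Q} trailSign c m` (resp. `-4 - ∑`)** — the
  winding of the `j`-th exploration dart is a function of the closing path alone.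

Everything is proved. [cite: DuminilCopinHonglerNolin2011, Lemma 12]

## References

* H. Duminil-Copin, C. Hongler, P. Nolin, *Connection probabilities and RSW-type bounds for the
  two-dimensional FK Ising model*, Comm. Pure Appl. Math. 64 (2011), §4, Lemma 12.
  [DuminilCopinHonglerNolin2011]
* H. Hopf, Compositio Math. 2 (1935), Satz I. [Hopf1935]
-/

namespace Literature.Probability.LatticeModels

open MedialTrail Finset

/-! ### Pinning the sign by an extreme horizontal dart (top and bottom rows) -/

namespace IsCornerTrail

variable {c : ℕ → Site 2 × Fin 4} {Q : ℕ}

/-- **Topmost westward dart ⇒ counter-clockwise.** If some dart of the trail has face index `1` (it points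
west in medial coordinates) and no point of the trail lies strictly above its row, the turn signs sum to
`+4` (the face above the dart, on its right, has winding number `0`). [cite: Hopf1935, Satz I] -/
theorem sum_trailSign_eq_four_of_top (h : IsCornerTrail c Q) {m₀ : ℕ} (hm₀ : m₀ < Q)
    (h1 : (c m₀).2 = 1) (htop : ∀ m < Q, (cpos (c m)).2 ≤ (cpos (c m₀)).2) :
    ∑ m ∈ range Q, trailSign c m = 4 := by
  have hstep := h.cpos_succ hm₀
  rw [h1] at hstep
  simp only [cdir, Matrix.cons_val] at hstep
  refine h.sum_trailSign_eq_four_of_wnd_rf (h.mem_cdarts hm₀) ?_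
  have hrf : rf (cpos (c m₀), cpos (c (m₀ + 1))) = ((cpos (c m₀)).1 - 1, (cpos (c m₀)).2) := by
    rw [hstep]; simp only [rf]; split_ifs <;> first | rfl | (exfalso; omega)
  rw [hrf]
  refine wnd_eq_zero_of_le fun P hP => ?_
  obtain ⟨m, hm, rfl⟩ := exists_of_mem_map hP
  exact htop m hm

/-- **Topmost eastward dart ⇒ clockwise** (face index `3`; the face above the dart, on its left, has
winding number `0`). [cite: Hopf1935, Satz I] -/
theorem sum_trailSign_eq_neg_four_of_top (h : IsCornerTrail c Q) {m₀ : ℕ} (hm₀ : m₀ < Q)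
    (h3 : (c m₀).2 = 3) (htop : ∀ m < Q, (cpos (c m)).2 ≤ (cpos (c m₀)).2) :
    ∑ m ∈ range Q, trailSign c m = -4 := by
  have hstep := h.cpos_succ hm₀
  rw [h3] at hstep
  simp only [cdir, Matrix.cons_val] at hstep
  refine h.sum_trailSign_eq_neg_four_of_wnd_lf (h.mem_cdarts hm₀) ?_
  have hlf : lf (cpos (c m₀), cpos (c (m₀ + 1))) = ((cpos (c m₀)).1, (cpos (c m₀)).2) := by
    rw [hstep]; simp only [lf]; split_ifs <;> first | rfl | (exfalso; omega)
  rw [hlf]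
  refine wnd_eq_zero_of_le fun P hP => ?_
  obtain ⟨m, hm, rfl⟩ := exists_of_mem_map hP
  exact htop m hm

/-- **Bottommost eastward dart ⇒ counter-clockwise** (face index `3`; the face below the dart, on its right,
has winding number `0`). [cite: Hopf1935, Satz I] -/
theorem sum_trailSign_eq_four_of_bot (h : IsCornerTrail c Q) {m₀ : ℕ} (hm₀ : m₀ < Q)
    (h3 : (c m₀).2 = 3) (hbot : ∀ m < Q, (cpos (c m₀)).2 ≤ (cpos (c m)).2) :
    ∑ m ∈ range Q, trailSign c m = 4 := by
  have hstep := h.cpos_succ hm₀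
  rw [h3] at hstep
  simp only [cdir, Matrix.cons_val] at hstep
  refine h.sum_trailSign_eq_four_of_wnd_rf (h.mem_cdarts hm₀) ?_
  have hrf : rf (cpos (c m₀), cpos (c (m₀ + 1))) = ((cpos (c m₀)).1, (cpos (c m₀)).2 - 1) := by
    rw [hstep]; simp only [rf]; split_ifs <;> first | rfl | (exfalso; omega)
  rw [hrf]
  refine wnd_eq_zero_of_gt fun P hP => ?_
  obtain ⟨m, hm, rfl⟩ := exists_of_mem_map hP
  have := hbot m hm
  omega

/-- **Bottommost westward dart ⇒ clockwise** (face index `1`; the face below the dart, on its left, has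
winding number `0`). [cite: Hopf1935, Satz I] -/
theorem sum_trailSign_eq_neg_four_of_bot (h : IsCornerTrail c Q) {m₀ : ℕ} (hm₀ : m₀ < Q)
    (h1 : (c m₀).2 = 1) (hbot : ∀ m < Q, (cpos (c m₀)).2 ≤ (cpos (c m)).2) :
    ∑ m ∈ range Q, trailSign c m = -4 := by
  have hstep := h.cpos_succ hm₀
  rw [h1] at hstep
  simp only [cdir, Matrix.cons_val] at hstep
  refine h.sum_trailSign_eq_neg_four_of_wnd_lf (h.mem_cdarts hm₀) ?_
  have hlf : lf (cpos (c m₀), cpos (c (m₀ + 1))) = ((cpos (c m₀)).1 - 1, (cpos (c m₀)).2 - 1) := by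
    rw [hstep]; simp only [lf]; split_ifs <;> first | rfl | (exfalso; omega)
  rw [hlf]
  refine wnd_eq_zero_of_gt fun P hP => ?_
  obtain ⟨m, hm, rfl⟩ := exists_of_mem_map hP
  have := hbot m hm
  omega

end IsCornerTrail

/-! ### The winding of an exploration prefix -/

/-- The turn count up to time `j` only sees the first `j` target edges. [cite: Smirnov2010, §4] -/
theorem turnCount_congr {β β' : Percolation.BondConfig (Site 2)} {c₀ : Site 2 × Fin 4} {j : ℕ}
    (h : ∀ i < j, (cTgt (cornerOrbit β c₀ i) ∈ β' ↔ cTgt (cornerOrbit β c₀ i) ∈ β)) :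
    turnCount β' c₀ j = turnCount β c₀ j := by
  unfold turnCount
  refine sum_congr rfl fun i hi => ?_
  rw [mem_range] at hi
  rw [cornerOrbit_congr c₀ h i hi.le]
  by_cases hm : cTgt (cornerOrbit β c₀ i) ∈ β
  · rw [turnSign_of_mem hm, turnSign_of_mem ((h i hi).2 hm)]
  · rw [turnSign_of_not_mem hm, turnSign_of_not_mem (fun h' => hm ((h i hi).1 h'))]

/-- The turn sign of the turning rule is the trail sign of its orbit. [cite: Smirnov2010, §4] -/
theorem turnSign_cornerOrbit_eq_trailSign (β : Percolation.BondConfig (Site 2)) (c₀ : Site 2 × Fin 4)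
    (i : ℕ) : turnSign β (cornerOrbit β c₀ i) = trailSign (cornerOrbit β c₀) i := by
  classical
  unfold trailSign
  have hsucc : cornerOrbit β c₀ (i + 1) = nextCorner β (cornerOrbit β c₀ i) := rfl
  by_cases hr : cornerOrbit β c₀ (i + 1) = rightSucc (cornerOrbit β c₀ i)
  · rw [if_pos hr, (turnSign_eq_neg_one_iff β _).2 (hsucc ▸ hr)]
  · rw [if_neg hr]
    by_cases hm : cTgt (cornerOrbit β c₀ i) ∈ β
    · exact absurd (hsucc.trans (nextCorner_eq_rightSucc hm)) hr
    · exact turnSign_of_not_mem hm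

/-- **The winding of an exploration prefix closed by a virtual path.** If a corner sequence `c`
agrees with the orbit of `c₀` under `β` up to time `j`, then the turn count of the orbit at time `j`
(the winding of the `j`-th dart relative to the first, in quarter turns) is `∑_{m<j} trailSign c m` —
whatever `c` does afterwards. [cite: DuminilCopinHonglerNolin2011, Lemma 12] -/
theorem turnCount_eq_sum_trailSign {β : Percolation.BondConfig (Site 2)} {c₀ : Site 2 × Fin 4} {j : ℕ}
    {c : ℕ → Site 2 × Fin 4} (hprefix : ∀ i ≤ j, c i = cornerOrbit β c₀ i) :
    turnCount β c₀ j = ∑ m ∈ range j, trailSign c m := by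
  classical
  unfold turnCount
  refine sum_congr rfl fun i hi => ?_
  rw [mem_range] at hi
  rw [turnSign_cornerOrbit_eq_trailSign]
  unfold trailSign
  rw [hprefix i hi.le, hprefix (i + 1) hi]

/-- Splitting the turn-sign sum of a closing trail at the end of the prefix. [folklore] -/
theorem sum_trailSign_split (c : ℕ → Site 2 × Fin 4) {j Q : ℕ} (hjQ : j ≤ Q) :
    ∑ m ∈ range Q, trailSign c m = ∑ m ∈ range j, trailSign c m + ∑ m ∈ Ico j Q, trailSign c m := by
  rw [← sum_range_add_sum_Ico _ hjQ]

/-- **Deterministic prefix winding, counter-clockwise closing (westmost southward dart).** If a closed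
corner trail `c` of length `Q ≥ j` extends the first `j` steps of the orbit of `c₀` under `β` and has a
southward dart in its westmost medial column, then
`turnCount β c₀ j = 4 - ∑_{j ≤ m < Q} trailSign c m`: the winding of the `j`-th exploration dart is
read off the closing path alone. [cite: DuminilCopinHonglerNolin2011, Lemma 12] -/
theorem turnCount_eq_of_west_south {β : Percolation.BondConfig (Site 2)} {c₀ : Site 2 × Fin 4}
    {j Q : ℕ} {c : ℕ → Site 2 × Fin 4} (hc : IsCornerTrail c Q) (hjQ : j ≤ Q)
    (hprefix : ∀ i ≤ j, c i = cornerOrbit β c₀ i) {m₀ : ℕ} (hm₀ : m₀ < Q) (h2 : (c m₀).2 = 2)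
    (hwest : ∀ m < Q, (cpos (c m₀)).1 ≤ (cpos (c m)).1) :
    turnCount β c₀ j = 4 - ∑ m ∈ Ico j Q, trailSign c m := by
  rw [turnCount_eq_sum_trailSign hprefix, ← hc.sum_trailSign_eq_four_of_west hm₀ h2 hwest,
    sum_trailSign_split c hjQ]
  ring

/-- **Deterministic prefix winding, clockwise closing (westmost northward dart).**
[cite: DuminilCopinHonglerNolin2011, Lemma 12] -/
theorem turnCount_eq_of_west_north {β : Percolation.BondConfig (Site 2)} {c₀ : Site 2 × Fin 4}
    {j Q : ℕ} {c : ℕ → Site 2 × Fin 4} (hc : IsCornerTrail c Q) (hjQ : j ≤ Q)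
    (hprefix : ∀ i ≤ j, c i = cornerOrbit β c₀ i) {m₀ : ℕ} (hm₀ : m₀ < Q) (h0 : (c m₀).2 = 0)
    (hwest : ∀ m < Q, (cpos (c m₀)).1 ≤ (cpos (c m)).1) :
    turnCount β c₀ j = -4 - ∑ m ∈ Ico j Q, trailSign c m := by
  rw [turnCount_eq_sum_trailSign hprefix, ← hc.sum_trailSign_eq_neg_four_of_west hm₀ h0 hwest,
    sum_trailSign_split c hjQ]
  ring

/-- **Deterministic prefix winding, counter-clockwise closing (eastmost northward dart).**
[cite: DuminilCopinHonglerNolin2011, Lemma 12] -/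
theorem turnCount_eq_of_east_north {β : Percolation.BondConfig (Site 2)} {c₀ : Site 2 × Fin 4}
    {j Q : ℕ} {c : ℕ → Site 2 × Fin 4} (hc : IsCornerTrail c Q) (hjQ : j ≤ Q)
    (hprefix : ∀ i ≤ j, c i = cornerOrbit β c₀ i) {m₀ : ℕ} (hm₀ : m₀ < Q) (h0 : (c m₀).2 = 0)
    (heast : ∀ m < Q, (cpos (c m)).1 ≤ (cpos (c m₀)).1) :
    turnCount β c₀ j = 4 - ∑ m ∈ Ico j Q, trailSign c m := by
  rw [turnCount_eq_sum_trailSign hprefix, ← hc.sum_trailSign_eq_four_of_east hm₀ h0 heast,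
    sum_trailSign_split c hjQ]
  ring

/-- **Deterministic prefix winding, clockwise closing (eastmost southward dart).**
[cite: DuminilCopinHonglerNolin2011, Lemma 12] -/
theorem turnCount_eq_of_east_south {β : Percolation.BondConfig (Site 2)} {c₀ : Site 2 × Fin 4}
    {j Q : ℕ} {c : ℕ → Site 2 × Fin 4} (hc : IsCornerTrail c Q) (hjQ : j ≤ Q)
    (hprefix : ∀ i ≤ j, c i = cornerOrbit β c₀ i) {m₀ : ℕ} (hm₀ : m₀ < Q) (h2 : (c m₀).2 = 2)
    (heast : ∀ m < Q, (cpos (c m)).1 ≤ (cpos (c m₀)).1) :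
    turnCount β c₀ j = -4 - ∑ m ∈ Ico j Q, trailSign c m := by
  rw [turnCount_eq_sum_trailSign hprefix, ← hc.sum_trailSign_eq_neg_four_of_east hm₀ h2 heast,
    sum_trailSign_split c hjQ]
  ring

/-- **Deterministic prefix winding, counter-clockwise closing (topmost westward dart).**
[cite: DuminilCopinHonglerNolin2011, Lemma 12] -/
theorem turnCount_eq_of_top_west {β : Percolation.BondConfig (Site 2)} {c₀ : Site 2 × Fin 4}
    {j Q : ℕ} {c : ℕ → Site 2 × Fin 4} (hc : IsCornerTrail c Q) (hjQ : j ≤ Q)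
    (hprefix : ∀ i ≤ j, c i = cornerOrbit β c₀ i) {m₀ : ℕ} (hm₀ : m₀ < Q) (h1 : (c m₀).2 = 1)
    (htop : ∀ m < Q, (cpos (c m)).2 ≤ (cpos (c m₀)).2) :
    turnCount β c₀ j = 4 - ∑ m ∈ Ico j Q, trailSign c m := by
  rw [turnCount_eq_sum_trailSign hprefix, ← hc.sum_trailSign_eq_four_of_top hm₀ h1 htop,
    sum_trailSign_split c hjQ]
  ring

/-- **Deterministic prefix winding, clockwise closing (topmost eastward dart).**
[cite: DuminilCopinHonglerNolin2011, Lemma 12] -/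
theorem turnCount_eq_of_top_east {β : Percolation.BondConfig (Site 2)} {c₀ : Site 2 × Fin 4}
    {j Q : ℕ} {c : ℕ → Site 2 × Fin 4} (hc : IsCornerTrail c Q) (hjQ : j ≤ Q)
    (hprefix : ∀ i ≤ j, c i = cornerOrbit β c₀ i) {m₀ : ℕ} (hm₀ : m₀ < Q) (h3 : (c m₀).2 = 3)
    (htop : ∀ m < Q, (cpos (c m)).2 ≤ (cpos (c m₀)).2) :
    turnCount β c₀ j = -4 - ∑ m ∈ Ico j Q, trailSign c m := by
  rw [turnCount_eq_sum_trailSign hprefix, ← hc.sum_trailSign_eq_neg_four_of_top hm₀ h3 htop,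
    sum_trailSign_split c hjQ]
  ring

/-- **Deterministic prefix winding, counter-clockwise closing (bottommost eastward dart).**
[cite: DuminilCopinHonglerNolin2011, Lemma 12] -/
theorem turnCount_eq_of_bot_east {β : Percolation.BondConfig (Site 2)} {c₀ : Site 2 × Fin 4}
    {j Q : ℕ} {c : ℕ → Site 2 × Fin 4} (hc : IsCornerTrail c Q) (hjQ : j ≤ Q)
    (hprefix : ∀ i ≤ j, c i = cornerOrbit β c₀ i) {m₀ : ℕ} (hm₀ : m₀ < Q) (h3 : (c m₀).2 = 3)
    (hbot : ∀ m < Q, (cpos (c m₀)).2 ≤ (cpos (c m)).2) :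
    turnCount β c₀ j = 4 - ∑ m ∈ Ico j Q, trailSign c m := by
  rw [turnCount_eq_sum_trailSign hprefix, ← hc.sum_trailSign_eq_four_of_bot hm₀ h3 hbot,
    sum_trailSign_split c hjQ]
  ring

/-- **Deterministic prefix winding, clockwise closing (bottommost westward dart).**
[cite: DuminilCopinHonglerNolin2011, Lemma 12] -/
theorem turnCount_eq_of_bot_west {β : Percolation.BondConfig (Site 2)} {c₀ : Site 2 × Fin 4}
    {j Q : ℕ} {c : ℕ → Site 2 × Fin 4} (hc : IsCornerTrail c Q) (hjQ : j ≤ Q)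
    (hprefix : ∀ i ≤ j, c i = cornerOrbit β c₀ i) {m₀ : ℕ} (hm₀ : m₀ < Q) (h1 : (c m₀).2 = 1)
    (hbot : ∀ m < Q, (cpos (c m₀)).2 ≤ (cpos (c m)).2) :
    turnCount β c₀ j = -4 - ∑ m ∈ Ico j Q, trailSign c m := by
  rw [turnCount_eq_sum_trailSign hprefix, ← hc.sum_trailSign_eq_neg_four_of_bot hm₀ h1 hbot,
    sum_trailSign_split c hjQ]
  ring

end Literature.Probability.LatticeModels
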